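import Literature.MathematicalPhysics.QuantumFieldTheory.Balaban1983to89.B2Eq276DerivHiggsRegion
import Literature.MathematicalPhysics.QuantumFieldTheory.Balaban1983to89.B2Eq273NeumannLocality

/-!
# `Balaban1983to89.B2Eq274DerivHiggsRegion` — [Balaban1982Higgs2] Lemma 2.4, proof steps **(2.69)–(2.70), (2.74) «for the
# derivative»** p. 572–573 ON THE (Higgs)₂,₃ CARRIER OF RECORD: gauging the CONSTANT configuration `A₀` away UNDER THE COVARIANT
# DERIVATIVE — the structure `(D^η_{A₀}(a_kG_k(□, A₀)Q_k^*(A₀)□₁φ))(b) = U(A₀(Γ_{b₋,o}))·(a_k∂^ηG_k(□, 0)Q_k^*□₁φ′)(b)` of the main term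
# of (2.77) («(D^η_{A^{(k)}}φ^{(k)})(b) = U(A₀(Γ_{b₋,y}))(a_k∂^ηG_k(□, 0)Q_k^*□₁φ′)(b) + O((Lᵏε)^{κ₀}), b ⊂ □»), from print's (2.70)
# «(D^η_{A₀}φ₀)(b) = U(A₀(Γ_{b₋,y}))(∂^ηφ′₀)(b)» — on the carrier by p23's F1/F2 (`B2Eq273GaugeCovariance` gauge covariance of
# (2.56) and of its covariant derivative, `B2Eq273NeumannLocality` locality of the Neumann operators in the field) — and, combined with
# own D3′ `B2Eq276DerivHiggsRegion`, the bound «(2.76) for the derivative» AT THE CONSTANT FIELD `A₀`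

statement-level skeleton of published theorems with citation tags; proofs where landed; nothing here is a claim
about the Yang–Mills mass gap

PDF held: `paper:balaban1982-cmp86-higgs23-ii` (journal page = PDF page + 554), p. 572 [PDF 18] ((2.69)–(2.70)), p. 573 [PDF 19]
((2.73)–(2.74), (2.77)), re-read this session on the ×2/×4 renders `run/shared/lean/pub/pub-balaban/b2b-balaban-ref1/pages/
1982-cmp86-higgs23-II/1982-cmp86-higgs23-II-p018-x2.png` / `…-p019-x2.png` / `…-p019-x4.png`.

CITATION HEADER (lean-in-tree rule).  T. Bałaban, *(Higgs)₂,₃ quantum fields in a finite volume. II. An upper bound*,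
Commun. Math. Phys. **86** (1982) 555–594, doi:10.1007/bf01214890 [Balaban1982Higgs2]; operators of T. Bałaban, *(Higgs)₂,₃
quantum fields in a finite volume. I. A lower bound*, Commun. Math. Phys. **85** (1982) 603–626 [Balaban1982Higgs1] AS TYPED by the
typer (`HiggsLattice`, `HiggsAveraging`, `HiggsCovariance`, `HiggsGaugeInvariance`, `B2Eq255Concrete`).  Cell `lit-balaban` (HOME
`run/shared/lean/pub/lit-balaban/`), reader/typer seat **r14** gen 21 (B2 second reader; unit `lit-balaban-r14-g21`; free-target protocol
G.5-34(d): the derivative lane D2′/D3′/D4′/D5 of row B2.Lem2.4 — owner r02 WELCOME 2026-08-23T07:13Z, p23 «no priority claimed» 07:20Z);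
SKELETON row **B2.Lem2.4** (Lemma 2.4 (2.65)–(2.66) p. 572; fold owner r02, second reader r14; decl of record `B2.Lemma24Printed`, head
`proved p250408 · …` UNCHANGED — cells-only member; brick D2′ of the located-residue item «the derivative clause (2.66)/(2.77)»).
Cross-references: rows **B1.Eq1.7**/**B1.Eq1.8** (gauge covariance of `D^ε_A`: the typer's `HiggsGaugeInvariance.covDeriv_gauge`),
**B2.Eq2.55** ((2.56)).  USED BY NAME, never restated: p23's F1 `B2Eq273GaugeCovariance.{covDeriv_bgScalar256_gauge, constVec,
cornerGauge, seamField, gaugeVec_cornerGauge, gaugeVec_neg_gaugeVec, U_cornerGauge, norm_rot_apply}`, p23's F2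
`B2Eq273NeumannLocality.{bgScalar256_congr, seamField_eq_zero_of_inside}`, the typer's `HiggsGaugeInvariance.{rot, gaugeVec, rot_neg_rot,
norm_U}`, `B2Eq255Concrete.{bgScalar256, underRegion, mem_underRegion}`, `HiggsCovariancePos.Inside`, own D3′
`B2Eq276DerivHiggsRegion.eq276_deriv_zero_region`, r14's `B1Ineq234Concrete.tdist_self` / `B1Ineq234LevelZero.tdist_shift_le_one`.

WHAT IS PRINTED (pp. 572–573 [PDF 18–19]).  *«Now the constant field A₀ can be "gauged out" from the last expression above. We use a
gauge transformation defined on □ by the formula φ₀(x) = U(A₀(Γ_{x,y}))φ′₀(x), x ∈ □, … We consider the terms determining the corresponding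
quadratic form: (D^η_{A₀}φ₀)(b) = η⁻¹(U(A₀,_b)U(A₀(Γ_{b₊,y}))φ′₀(b₊) − U(A₀(Γ_{b₋,y}))φ′₀(b₋)) = U(A₀(Γ_{b₋,y}))η⁻¹(U(A₀(Γ_{y,b₋} ∪ b ∪
Γ_{b₊,y}))φ′₀(b₊) − φ′₀(b₋)), (2.69) but the contour Γ_{y,b₋} ∪ b ∪ Γ_{b₊,y} is closed and bounds some surface Σ ⊂ □, so using Stokes'
theorem we have A₀(Γ_{y,b₋} ∪ b ∪ Γ_{b₊,y}) = A₀(∂Σ) = ∂^ηA₀(Σ) = 0, hence (D^η_{A₀}φ₀)(b) = U(A₀(Γ_{b₋,y}))(∂^ηφ′₀)(b), and |(D^η_{A₀}φ₀)(b)|² =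
|(∂^ηφ′₀)(b)|² for b ⊂ □. (2.70) … Together with the gauge transformation of the propagators we make the corresponding transformation
of the field φ, i.e. φ(y′) = U(A₀(Γ_{y′,y}))φ′(y′). Then the last expression in (2.68) transforms itself as follows
(a_kG_k(□, A₀)Q_k^*(A₀)□₁φ)(x) = U(A₀(Γ_{x,y}))(a_kG_k(□, 0)Q_k^*□₁φ′)(x). (2.74) … It was mentioned several times that the corresponding
equalities hold for the covariant derivatives of φ^{(k)} and we have (D^η_{A^{(k)}}φ^{(k)})(b) = U(A₀(Γ_{b₋,y}))(a_k∂^ηG_k(□, 0)Q_k^*□₁φ′)(b)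
+ O((Lᵏε)^{κ₀}), b ⊂ □. (2.77)»* (the last display transcribed from the renders p019; the text layer's «bcΠ-» is «b ⊂ □.»).

THE ARGUMENT (on the carrier).  p23's F1 proves, for EVERY gauge `λ`, field `A` and regions, the covariance of the typer's (2.56)
`φ^{(k)}[A − ∂λ, U(λ_k)φ] = U(λ)φ^{(k)}[A, φ]` (`bgScalar256_gauge`) and — with the typer's (I.1.7) covariance `D^ε_{A−∂λ}(U(λ)f)(b) =
U(λ(b₋))(D^ε_Af)(b)` — of its covariant derivative (`covDeriv_bgScalar256_gauge`).  For print's constant `A₀ = constVec c` take `λ = −λ_o`,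
`λ_o(z) = εΣ_μ c_μ n_μ(z − o)` the corner gauge (F1 §7): `A₀ + A′ = (A′ + (A₀ − ∂λ_o)) − ∂(−λ_o)` (`gaugeVec_neg_gaugeVec`, `gaugeVec_cornerGauge`),
so `D^ε_{A₀+A′}φ^{(k)}[A₀ + A′, φ](b) = U(−λ_o(b₋))·D^ε_{A′+seam}φ^{(k)}[A′ + seam, φ′](b)`, `φ′ = U(λ_{o,k})φ`, `seam = A₀ − ∂λ_o` the seam
field (zero on every non-wrapping bond).  On a region `Ω = Bᵏ(□₂)` lying in the window above `o` every inside bond is off the seam (F2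
`seamField_eq_zero_of_inside`), the background field does not see the field off `Ω` (F2 `bgScalar256_congr`) and `(D^ε_Bf)(b)` depends on `B`
only through `B_b` — hence for `b` inside `Ω`: `D^ε_{A₀+A′}φ^{(k)}[A₀ + A′, φ](b) = U(A₀(Γ_{b₋,o}))·D^ε_{A′}φ^{(k)}[A′, φ′](b)`, print's case
being `A′ = 0` — the main term of (2.77) EXACTLY; norms agree (`|U| = 1`), and own D3′ bounds the right side.

WHAT THIS FILE PROVES (kernel-checked, zero `sorry`; theorems only — NO definition, NO `Prop`-valued fact; axioms standard).
 §1 `covDeriv_congr_bond` (`(D^ε_Bf)(b)` depends on `B` only through `B_b`), `inside_of_depth` (both ends of `⟨x, x+εe_μ⟩` lie in `Ω` when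
    the unit ball about `x` does).
 §2 **`covDeriv_bgScalar256_constVec`** — (2.69)–(2.70)/(2.74) for the derivative, EXACT on the whole torus with the seam field:
    `D^ε_{A₀+A′}φ^{(k)}_{Λ₂,Λ₆}[A₀ + A′, φ](b) = U(A₀(Γ_{b₋,o}))·D^ε_{A′+seam}φ^{(k)}_{Λ₂,Λ₆}[A′ + seam, φ′](b)` (every `Λ₂, Λ₆, A′, φ, b, o`).
 §3 **`covDeriv_bgScalar256_constVec_local`** / **`covDeriv_bgScalar256_constVec_zero`** — the same on `Ω = Bᵏ(□₂)` in the window above `o`,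
    `□₁ ⊆ □₂`, for the bonds inside `Ω`: the seam field dropped (print's (2.77) main term, `A′ = 0`);
    **`norm_covDeriv_bgScalar256_constVec_zero`** (`‖D^ε_{A₀}φ^{(k)}[A₀, φ](b)‖ = ‖D^ε_0φ^{(k)}[0, φ′](b)‖`, print's (2.70) «|(D^η_{A₀}φ₀)(b)|² =
    |(∂^ηφ′₀)(b)|²» for the background field).
 §4 **`eq276_deriv_const_region`** — «(2.76) for the derivative» AT THE CONSTANT FIELD: own D3′ `eq276_deriv_zero_region` transported by §3:
    `‖(D^ε_{A₀}(a_kG_k(□, A₀)Q_k^*(A₀)□₁φ))(b)‖ ≤ a_k·C₁·(Lᵏε)⁻¹·(4K₀λ′ + e^{−ρ/(4K₀)}|φ(ȳ)|)`, `λ′` the Lipschitz modulus about `ȳ` on `□₁` of the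
    GAUGED field `φ′ = U(λ_{o,k})φ` — D3′'s statement word for word except: the field `0 ↦ constVec c` (both occurrences), `+ (o : Site P 0)`
    with the window hypothesis of F2, the Lipschitz hypothesis on `φ ↦ φ′ := rot C (λ_o ∘ toFinest) φ`, and `‖φ(ȳ)‖` kept (`= ‖φ′(ȳ)‖`).

HONEST SCOPE / DIFFERENCES FROM PRINT (recorded, not hidden; one sentence each).  (a) GAUGE BASE POINT: the corner `o` of a window
containing `□` instead of print's `y` (F1's HONEST SCOPE (c): the two gauge functions differ on `□` by the constant `εA₀(Γ_{o,y})`, immaterial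
for (2.70)/(2.74)/(2.77)); the factor is written `U(A₀(Γ_{b₋,o}))` = `C.U ε (−contourSum A₀ o b₋)` as in F2.  (b) WINDOW: `Ω = Bᵏ(□₂)` must lie
in the window above `o` (no site on the hyperplanes `z_μ = o_μ − ε`) — F2's hypothesis, discharged for a proper box of `k`-sites by F2's
`window_of_kbox`; print's `□` is such a box around `y`.  (c) §2 is exact on the whole torus WITH the seam field `A₀ − ∂λ_o` (the holonomy of
the constant field around the torus); §3 drops it only inside `Ω`.  (d) §4 is ZERO-EXTERNAL-`A′` («A′ = 0», print's (2.74)/(2.77)) and the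
MAIN TERM only: the `O((Lᵏε)^{κ₀})` remainder of (2.77) ((2.67)/(2.68) for the derivative) and the assembly to (2.66) are NOT here — (2.67)
for the derivative IS in the tree (p23's `B2Eq267HiggsRegion.eq267_deriv_higgs_region`), (2.68) for the derivative and the assembly are
the later bricks D4′/D5; the Lipschitz modulus `λ′` of the gauged field is a free letter (print: «|φ′(y″) − φ′(y′)| ≦ O(1)p(Lᵏε)», fed by name from
(2.55)₃ through F6's `cov_const_of_cov_barA` in the value clause — the same reading applies here and is the assembly's business).
(e) Everything else as in D3′ (ε-lattice currency `(Lᵏε)⁻¹`, block of the bond = block of `b₋`, depth `2r_S + 2LᵏK₀(d+1) + 1`, constants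
F3′'s/p17's, nothing minted).  NOT summit progress.
-/

open scoped BigOperators

noncomputable section

namespace Literature.MathematicalPhysics.QuantumFieldTheory.Balaban1983to89.B2Eq274DerivHiggsRegion

open Literature.MathematicalPhysics.QuantumFieldTheory.Balaban1983to89.HiggsLattice
open Literature.MathematicalPhysics.QuantumFieldTheory.Balaban1983to89.HiggsAveraging
open Literature.MathematicalPhysics.QuantumFieldTheory.Balaban1983to89.HiggsCovariance
open Literature.MathematicalPhysics.QuantumFieldTheory.Balaban1983to89.HiggsCovariancePos
open Literature.MathematicalPhysics.QuantumFieldTheory.Balaban1983to89.HiggsGaugeInvariance (rot gaugeVec rot_neg_rot norm_U)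
open Literature.MathematicalPhysics.QuantumFieldTheory.Balaban1983to89.B2Eq255Concrete (bgScalar256 underRegion mem_underRegion)
open Literature.MathematicalPhysics.QuantumFieldTheory.Balaban1983to89.B2Eq273GaugeCovariance (covDeriv_bgScalar256_gauge constVec
  cornerGauge seamField gaugeVec_cornerGauge gaugeVec_neg_gaugeVec U_cornerGauge norm_rot_apply)
open Literature.MathematicalPhysics.QuantumFieldTheory.Balaban1983to89.B2Eq273NeumannLocality (bgScalar256_congr
  seamField_eq_zero_of_inside)
open Literature.MathematicalPhysics.QuantumFieldTheory.Balaban1983to89.B2Eq276DerivHiggsRegion (eq276_deriv_zero_region)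
open Literature.MathematicalPhysics.QuantumFieldTheory.Balaban1983to89.B1Ineq234Concrete (tdist_self)
open Literature.MathematicalPhysics.QuantumFieldTheory.Balaban1983to89.B1Ineq234LevelZero (tdist_shift_le_one)
open Literature.MathematicalPhysics.QuantumFieldTheory.Balaban1983to89.B1TorusRegionHSizes (IsBigBlockUnion)
open Literature.MathematicalPhysics.QuantumFieldTheory.Balaban1983to89.B1TorusCubeCover (half)
open Literature.MathematicalPhysics.QuantumFieldTheory.Balaban1983to89.B1TorusCubeLocality26 (rS)

variable {P : HiggsLattice.Params} {N : ℕ}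

/-! ## §1 Two pieces of bookkeeping -/

section Bookkeeping

variable (C : ChargeData N)

/-- `(D^ε_Bf)(b)` depends on the field only through its value on the bond `b` ((I.1.7): `η⁻¹(U(B_b)f(b₊) − f(b₋))`).
[cite: Balaban1982Higgs1, (1.7) p.605] -/
theorem covDeriv_congr_bond {k : ℕ} {B B' : HiggsLattice.VecField P k} (f : HiggsLattice.ScalarField P k N) {b : HiggsLattice.PBond P k}
    (h : B b = B' b) : covDeriv C B f b = covDeriv C B' f b := by
  unfold covDeriv
  rw [h]

/-- both ends of the bond `⟨x, x + εe_μ⟩` lie in `Ω` when the ball `{|z − x| ≤ R}`, `R ≥ 1`, does. [cite: Balaban1982Higgs1, (1.3)–(1.4) p.604] -/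
theorem inside_of_depth {Ω : Finset (HiggsLattice.Site P 0)} {x : HiggsLattice.Site P 0} {R : ℕ} (hR : 1 ≤ R)
    (hx : ∀ z, HiggsLattice.Site.tdist x z ≤ R → z ∈ Ω) (μ : Fin P.d) : Inside Ω (⟨x, μ⟩ : HiggsLattice.PBond P 0) :=
  ⟨hx x (by rw [tdist_self]; exact Nat.zero_le _), hx (x.shift μ) ((tdist_shift_le_one x μ).trans hR)⟩

end Bookkeeping

/-! ## §2 (2.69)–(2.70)/(2.74) FOR THE DERIVATIVE, exact on the whole torus (with the seam field) -/

section Global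

variable (C : ChargeData N) {k : ℕ}

/-- **(2.74) FOR THE COVARIANT DERIVATIVE, IN PRINT'S LETTERS, EXACT**: for `A = A₀ + A′` with `A₀ = constVec c` constant and any corner `o`,
`(D^ε_{A₀+A′}φ^{(k)}[A₀ + A′, φ])(b) = U(A₀(Γ_{b₋,o}))·(D^ε_{A′+(A₀−∂λ_o)}φ^{(k)}[A′ + (A₀ − ∂λ_o), φ′])(b)` with `φ′(y′) = U(λ_o(ȳ′))φ(y′) =
U(A₀(Γ_{o,ȳ′}))φ(y′)` — print's (2.70) «(D^η_{A₀}φ₀)(b) = U(A₀(Γ_{b₋,y}))(∂^ηφ′₀)(b)» and (2.77)'s main-term structure, on the whole torus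
(where the constant field cannot be gauged to zero: its holonomy survives as the seam field `A₀ − ∂λ_o`, zero off the seam).
[cite: Balaban1982Higgs2, Lemma 2.4 proof (2.69)–(2.70) p.572] [cite: Balaban1982Higgs2, Lemma 2.4 proof (2.74), (2.77) p.573] -/
theorem covDeriv_bgScalar256_constVec (msq a : ℝ) (k : ℕ) (Λ₂ Λ₆ : Finset (HiggsLattice.Site P k)) (o : HiggsLattice.Site P 0)
    (c : Fin P.d → ℝ) (A' : HiggsLattice.VecField P 0) (φ : HiggsLattice.ScalarField P k N) (b : HiggsLattice.PBond P 0) :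
    covDeriv C (constVec c + A') (bgScalar256 C msq a k Λ₂ Λ₆ (constVec c + A') φ) b
      = C.U (P.mesh 0) (-contourSum (constVec c) o b.src)
          (covDeriv C (A' + seamField o c)
            (bgScalar256 C msq a k Λ₂ Λ₆ (A' + seamField o c) (rot C (fun y => cornerGauge o c (toFinest y)) φ)) b) := by
  have h := covDeriv_bgScalar256_gauge C msq a k Λ₂ Λ₆ (-cornerGauge o c) (gaugeVec (cornerGauge o c) (constVec c + A'))
    (rot C (fun y => cornerGauge o c (toFinest y)) φ) b
  rw [gaugeVec_neg_gaugeVec, gaugeVec_cornerGauge] at h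
  have hφ : rot C (fun y => (-cornerGauge o c) (toFinest y)) (rot C (fun y => cornerGauge o c (toFinest y)) φ) = φ :=
    rot_neg_rot C (fun y => cornerGauge o c (toFinest y)) φ
  rw [hφ] at h
  rw [h, Pi.neg_apply, (U_cornerGauge C o c b.src).2]

end Global

/-! ## §3 The same on a region off the seam: print's (2.77) main term, and the equality of norms (2.70) -/

section Local

variable (C : ChargeData N) {k : ℕ}

/-- **(2.74)/(2.77) FOR THE DERIVATIVE AS PRINTED (general `A′`)**: for `□₁ ⊆ □₂ ⊂ T^{(k)}` with `Ω = Bᵏ(□₂)` in the window above `o`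
(`m² > 0`, `a_k ≥ 0`, `k ≤ K`), a constant `A₀` and any `A′`, on every bond `b` with both ends in `Ω`:
`(D^ε_{A₀+A′}φ^{(k)}_□[A₀ + A′, φ])(b) = U(A₀(Γ_{b₋,o}))·(D^ε_{A′}φ^{(k)}_□[A′, φ′])(b)` — the seam field is invisible inside `Ω`
(F2's locality of (2.56) in the field + `covDeriv_congr_bond`). [cite: Balaban1982Higgs2, Lemma 2.4 proof (2.70) p.572, (2.74)/(2.77) p.573] -/
theorem covDeriv_bgScalar256_constVec_local {msq a : ℝ} (hmsq : 0 < msq) (hak : 0 ≤ B1.aSeq a P.L k) (hk : k ≤ P.K)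
    (sq₂ sq₁ : Finset (HiggsLattice.Site P k)) (h12 : sq₁ ⊆ sq₂) (o : HiggsLattice.Site P 0)
    (hwin : ∀ z ∈ underRegion k sq₂, ∀ μ : Fin P.d, (z μ - o μ).val + 1 < P.sitesPerDir 0 μ)
    (c : Fin P.d → ℝ) (A' : HiggsLattice.VecField P 0) (φ : HiggsLattice.ScalarField P k N) {b : HiggsLattice.PBond P 0}
    (hb : Inside (underRegion k sq₂) b) :
    covDeriv C (constVec c + A') (bgScalar256 C msq a k sq₂ sq₁ (constVec c + A') φ) b
      = C.U (P.mesh 0) (-contourSum (constVec c) o b.src)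
          (covDeriv C A' (bgScalar256 C msq a k sq₂ sq₁ A' (rot C (fun y => cornerGauge o c (toFinest y)) φ)) b) := by
  have hseam : ∀ b' : HiggsLattice.PBond P 0, Inside (underRegion k sq₂) b' → (A' + seamField o c) b' = A' b' := fun b' hb' => by
    rw [Pi.add_apply, seamField_eq_zero_of_inside o c hwin b' hb', add_zero]
  rw [covDeriv_bgScalar256_constVec C msq a k sq₂ sq₁ o c A' φ b,
    bgScalar256_congr C hmsq hak hk sq₂ sq₁ h12 (B := A' + seamField o c) (B' := A') hseam,
    covDeriv_congr_bond C _ (hseam b hb)]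

/-- **(2.77) main term as printed, `A′ = 0`**: `(D^ε_{A₀}φ^{(k)}_□[A₀, φ])(b) = U(A₀(Γ_{b₋,o}))·(D^ε_0φ^{(k)}_□[0, φ′])(b)` for the bonds inside
`Ω = Bᵏ(□₂)` — print: «(D^η_{A^{(k)}}φ^{(k)})(b) = U(A₀(Γ_{b₋,y}))(a_k∂^ηG_k(□, 0)Q_k^*□₁φ′)(b) + …», here its `A^{(k)} = A₀` part exactly.
[cite: Balaban1982Higgs2, Lemma 2.4 proof (2.77) p.573] [cite: Balaban1982Higgs2, Lemma 2.4 proof (2.70) p.572] -/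
theorem covDeriv_bgScalar256_constVec_zero {msq a : ℝ} (hmsq : 0 < msq) (hak : 0 ≤ B1.aSeq a P.L k) (hk : k ≤ P.K)
    (sq₂ sq₁ : Finset (HiggsLattice.Site P k)) (h12 : sq₁ ⊆ sq₂) (o : HiggsLattice.Site P 0)
    (hwin : ∀ z ∈ underRegion k sq₂, ∀ μ : Fin P.d, (z μ - o μ).val + 1 < P.sitesPerDir 0 μ)
    (c : Fin P.d → ℝ) (φ : HiggsLattice.ScalarField P k N) {b : HiggsLattice.PBond P 0} (hb : Inside (underRegion k sq₂) b) :
    covDeriv C (constVec c) (bgScalar256 C msq a k sq₂ sq₁ (constVec c) φ) b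
      = C.U (P.mesh 0) (-contourSum (constVec c) o b.src)
          (covDeriv C (0 : HiggsLattice.VecField P 0)
            (bgScalar256 C msq a k sq₂ sq₁ (0 : HiggsLattice.VecField P 0) (rot C (fun y => cornerGauge o c (toFinest y)) φ)) b) := by
  have h := covDeriv_bgScalar256_constVec_local C hmsq hak hk sq₂ sq₁ h12 o hwin c 0 φ hb
  rwa [add_zero] at h

/-- **(2.70) for the background field: the norms agree** — `‖(D^ε_{A₀}φ^{(k)}_□[A₀, φ])(b)‖ = ‖(D^ε_0φ^{(k)}_□[0, φ′])(b)‖` on the bonds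
inside `Ω = Bᵏ(□₂)` (print: «|(D^η_{A₀}φ₀)(b)|² = |(∂^ηφ′₀)(b)|² for b ⊂ □»; `|U| = 1`).
[cite: Balaban1982Higgs2, Lemma 2.4 proof (2.70) p.572] [cite: Balaban1982Higgs2, Lemma 2.4 proof (2.77) p.573] -/
theorem norm_covDeriv_bgScalar256_constVec_zero {msq a : ℝ} (hmsq : 0 < msq) (hak : 0 ≤ B1.aSeq a P.L k) (hk : k ≤ P.K)
    (sq₂ sq₁ : Finset (HiggsLattice.Site P k)) (h12 : sq₁ ⊆ sq₂) (o : HiggsLattice.Site P 0)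
    (hwin : ∀ z ∈ underRegion k sq₂, ∀ μ : Fin P.d, (z μ - o μ).val + 1 < P.sitesPerDir 0 μ)
    (c : Fin P.d → ℝ) (φ : HiggsLattice.ScalarField P k N) {b : HiggsLattice.PBond P 0} (hb : Inside (underRegion k sq₂) b) :
    ‖covDeriv C (constVec c) (bgScalar256 C msq a k sq₂ sq₁ (constVec c) φ) b‖
      = ‖covDeriv C (0 : HiggsLattice.VecField P 0)
          (bgScalar256 C msq a k sq₂ sq₁ (0 : HiggsLattice.VecField P 0) (rot C (fun y => cornerGauge o c (toFinest y)) φ)) b‖ := by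
  rw [covDeriv_bgScalar256_constVec_zero C hmsq hak hk sq₂ sq₁ h12 o hwin c φ hb, norm_U]

end Local

/-! ## §4 «(2.76) for the derivative» AT THE CONSTANT FIELD `A₀` -/

section Eq276DerivConst

/-- **(2.76) «FOR THE DERIVATIVE» AT THE CONSTANT FIELD, ON THE (Higgs)₂,₃ CARRIER** — own D3′ transported through (2.70)/(2.74).
For `d ≥ 1`, `L ≥ 2`, `a, m² > 0`, `N`, charge data and a mesh cap `ε₀`: there are `K₀min` and, for every cube size `K₀ ≥ K₀min`, a
constant `C₁ ≥ 0` (D3′'s) such that on every torus of the carrier with `K₀ ∣ M`, at every level `1 ≤ k ≤ K_P` with `3LᵏK₀ ≤ |T_ε|_μ` and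
`Lᵏε ≤ ε₀`, for all `□₁ ⊆ □₂ ⊂ T^{(k)}` with `Ω = Bᵏ(□₂)` a big-block union lying in the window above a corner `o`, every constant field
`A₀ = constVec c`, every bond `b = ⟨x, x + εe_μ⟩` with `{|z − x| ≤ 2r_S + 2LᵏK₀(d+1) + 1} ⊂ Ω` (`ȳ = x_k`), every unit-lattice field `φ`
whose GAUGED field `φ′ = U(λ_{o,k})φ` satisfies `|φ′(y′) − φ′(ȳ)| ≤ λ′|ȳ − y′|` on `□₁` (`λ′ ≥ 0`), and every `ρ ≤ |ȳ − y′|` for all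
`y′ ∈ □₂ ∖ □₁`: `‖(D^ε_{A₀}(a_kG_k(□, A₀)Q_k^*(A₀)□₁φ))(b)‖ ≤ a_k·C₁·(Lᵏε)⁻¹·(4K₀λ′ + e^{−ρ/(4K₀)}|φ(ȳ)|)`.  TYPED vs PRINTED: D3′'s
`eq276_deriv_zero_region` word for word except: `+ (o : Site P 0)` with F2's window hypothesis after the big-block hypothesis; `+ (c : Fin P.d
→ ℝ)`; the Lipschitz hypothesis is on `rot C (fun y => cornerGauge o c (toFinest y)) φ` instead of `φ`; the field `0 ↦ constVec c` at both
places of the left side; the right side unchanged (`‖φ′(ȳ)‖ = ‖φ(ȳ)‖`).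
[cite: Balaban1982Higgs2, Lemma 2.4 proof (2.76)–(2.77) p.573] [cite: Balaban1982Higgs2, Lemma 2.4 proof (2.70), (2.74) pp.572–573]
[cite: Balaban1982Higgs2, Lemma 2.4 (2.66) p.572] -/
theorem eq276_deriv_const_region (d L : ℕ) (hd : 1 ≤ d) (hL : 2 ≤ L) {a : ℝ} (ha : 0 < a) {msq : ℝ} (hmsq : 0 < msq)
    (N : ℕ) (C : ChargeData N) (ε₀ : ℝ) :
    ∃ K₀min : ℕ, ∀ K₀ : ℕ, K₀min ≤ K₀ → ∃ C₁ : ℝ, 0 ≤ C₁ ∧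
      ∀ (P : HiggsLattice.Params), P.d = d → P.L = L → K₀ ∣ P.M →
      ∀ {k : ℕ}, 1 ≤ k → k ≤ P.K → (∀ μ, 3 * half P k K₀ ≤ P.sitesPerDir 0 μ) → P.mesh k ≤ ε₀ →
      ∀ (sq₂ sq₁ : Finset (HiggsLattice.Site P k)), sq₁ ⊆ sq₂ → IsBigBlockUnion k K₀ (underRegion k sq₂) →
      ∀ (o : HiggsLattice.Site P 0), (∀ z ∈ underRegion k sq₂, ∀ μ : Fin P.d, (z μ - o μ).val + 1 < P.sitesPerDir 0 μ) →
      ∀ (c : Fin P.d → ℝ) (x : HiggsLattice.Site P 0) (μ : Fin P.d),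
        (∀ z, HiggsLattice.Site.tdist x z ≤ 2 * rS P k K₀ + 2 * half P k K₀ * (P.d + 1) + 1 → z ∈ underRegion k sq₂) →
      ∀ (φ : HiggsLattice.ScalarField P k N) (lam : ℝ), 0 ≤ lam →
        (∀ y ∈ sq₁, ‖rot C (fun y => cornerGauge o c (toFinest y)) φ y - rot C (fun y => cornerGauge o c (toFinest y)) φ (blockIter k x)‖
            ≤ lam * (HiggsLattice.Site.tdist (blockIter k x) y : ℝ)) →
      ∀ (ρ : ℝ), (∀ y ∈ sq₂, y ∉ sq₁ → ρ ≤ (HiggsLattice.Site.tdist (blockIter k x) y : ℝ)) →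
        ‖covDeriv C (constVec c) (bgScalar256 C msq a k sq₂ sq₁ (constVec c) φ) (⟨x, μ⟩ : HiggsLattice.PBond P 0)‖
          ≤ B1.aSeq a P.L k * C₁ * (P.mesh k)⁻¹ *
              (4 * K₀ * lam + Real.exp (-(1 / (4 * K₀) * ρ)) * ‖φ (blockIter k x)‖) := by
  obtain ⟨K₀min, h⟩ := eq276_deriv_zero_region d L hd hL ha hmsq N C ε₀
  refine ⟨K₀min, fun K₀ hK₀ => ?_⟩
  obtain ⟨C₁, hC₁, h1⟩ := h K₀ hK₀
  refine ⟨C₁, hC₁, ?_⟩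
  intro P hPd hPL hK₀M k hk1 hk hsz hε sq₂ sq₁ h12 hΩ o hwin c x μ hx φ lam hlam hlip ρ hρ
  have hak : 0 ≤ B1.aSeq a P.L k := by
    have hL1 : (1 : ℝ) < P.L := by rw [hPL]; exact_mod_cast hL
    exact (B1.aSeq_pos ha hL1 hk1).le
  have hb : Inside (underRegion k sq₂) (⟨x, μ⟩ : HiggsLattice.PBond P 0) := inside_of_depth (by omega) hx μ
  rw [norm_covDeriv_bgScalar256_constVec_zero C hmsq hak hk sq₂ sq₁ h12 o hwin c φ hb,
    ← norm_rot_apply C (fun y => cornerGauge o c (toFinest y)) φ (blockIter k x)]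
  exact h1 P hPd hPL hK₀M hk1 hk hsz hε sq₂ sq₁ h12 hΩ x μ hx _ lam hlam hlip ρ hρ

end Eq276DerivConst

end Literature.MathematicalPhysics.QuantumFieldTheory.Balaban1983to89.B2Eq274DerivHiggsRegion

end
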